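import Summits.Ventures.LatticeQCDFlow.TrivializingMaps.FisherRadiusExact
import Summits.Ventures.LatticeQCDFlow.TrivializingMaps.FisherStaircaseChain

/-!
HONEST FRAMING: exact (Metropolis-corrected) sampling algorithms for lattice gauge theory; figures
of merit are autocorrelation/cost numbers at stated couplings and volumes; no continuum-physics
claim.

# FisherStaircase — THEOREM S (THEORY-1.md §31): a perturbative STAIRCASE of re-expanded
flow-constant series from coupling `0` to `β` needs at least `log`-many stages in
(distance of the coupling interval's ends to a Fisher zero `s₀` of `Z_L`) / `|Im s₀|`

Proposed tree path: `Summits/Ventures/LatticeQCDFlow/TrivializingMaps/FisherStaircase.lean` (OURS —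
venture-side, never `Literature/`). Docks `FisherStaircaseChain` (shifted F″ + chain-of-discs
count) to the lattice partition function of `FisherRadiusIdentity/Exact`. Cell `lqcd-flow`
(pub-lqcd), unit `pub-lqcd-theory1-g19`, 2026-08-22.

Setting ([Luscher2010Trivializing] §2, §4): smooth action `S` on `SU(n)^E` (periodic `(ℤ/L)^d`),
`Z(s) = ∫ D[U] e^{-sS} = complexMGF (-S) D[U] s` (entire, `Z(0) = 1`, `Z > 0` on `ℝ`), and its
logarithmic derivative `Z′/Z = -⟨S⟩_s` (`deriv_actionZ_eq`), whose Taylor series at `0` IS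
Lüscher's flow-constant series (THEOREM F″(i); `Staircase.luscher_stage_zero` below) with radius
EXACTLY `|s₀|`, `s₀` the nearest Fisher zero (F″(ii)–(iii)). To continue past `|s₀|` along the
real coupling axis one re-expands: a `K`-stage STAIRCASE with margin `η ∈ (0,1)` is a chain of
real couplings `x₀ ≤ x₁ ≤ … ≤ x_K` such that stage `k` (the Taylor series of `Z′/Z` at `x_k`) is
summable at `x_k + Δ_k/(1-η)`, `Δ_k = x_{k+1} - x_k` — the step uses at most the fraction `1-η`
of the stage's radius, so `N` terms of stage `k` are accurate to `O((1-η)^N)` on its step. (Stage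
`k ≥ 1` is, on paper, the constants' component of Lüscher's construction BASED AT the ensemble
`e^{-x_k S}D[U]/Z(x_k)` — same integration-by-parts identity `Ċ·Z = Z′`, THEORY-1 §31.2; in Lean
the stages are the re-centred Taylor series of `Z′/Z` and nothing else is claimed.)

Results (all `[ours]`):
* `actionZ_ofReal_pos/ne_zero`, `im_ne_zero_of_actionZ_eq_zero` [folklore]: `Z(x) > 0` for real
  `x` (every real coupling is a legitimate centre; Fisher zeros are off the axis).
* `Staircase.luscher_stage_zero`: `(k!)⁻¹(Z′/Z)^{(k)}(0) = Ċ^{(k)}` for every smooth Lüscher series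
  — stage `0` is Lüscher's series [cite: Luscher2010Trivializing §4.2–4.3].
* `Staircase.step_le_of_stage_summable`: an `η`-admissible stage at `x` has `Δ ≤ (1-η)|x - s₀|`
  for EVERY zero `s₀` of `Z` (shifted F″(iii)).
* §1 (pure, real chains `x_{k+1} - x_k ≤ (1-η)|x_k - z|`, `z ∉ ℝ`): the QUASIHYPERBOLIC form of
  the chain count, in closed form — `Staircase.arsinh_le_arsinh_add_log` (one step has
  quasihyperbolic length `≤ log(1/η)`: `arsinh V ≤ arsinh u + log(1/η)` whenever
  `V ≤ u + (1-η)√(1+u²)`) and **`Staircase.arsinh_sub_arsinh_le`**: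
  `K log(1/η) ≥ arsinh((x_K - Re z)/|Im z|) - arsinh((x₀ - Re z)/|Im z|) = ∫_{x₀}^{x_K} dx/|x - z|`
  (the Gehring–Palka length of the segment in `ℂ ∖ {z}`; no monotonicity needed).
* **`Staircase.actionZ_pow_mul_dist_le`, `Staircase.actionZ_count_ge`,
  `Staircase.actionZ_arsinh_sub_le` (THEOREM S).** For every zero `s₀` of `Z` and every
  `η`-margined `K`-stage staircase `x₀ ≤ … ≤ x_K`: `η^K |x₀ - s₀| ≤ |x_K - s₀|`;
  `K log(1/η) ≥ arsinh((x_K - Re s₀)/|Im s₀|) - arsinh((x₀ - Re s₀)/|Im s₀|)`; and if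
  `x₀ < Re s₀ ≤ x_K` also
  `K ≥ log(|x₀ - s₀|√(η(2-η))/|Im s₀|)/log(1/η) + log(|x_K - s₀|√(η(2-η))/|Im s₀|)/log(2-η)`.
  Wilson action (`S_W = ∑_p Re tr(1 - U_p)`, `s = β/N`): `wilson_staircase_count_ge`,
  `wilson_staircase_arsinh_le`; and the converse side `wilson_one_stage_of_uniform_radius`: below
  the volume-uniform zero-free radius `ρ` of `wilson_actionZ_zeroFree_uniform` (THEOREM A + F′)
  ONE stage serves every volume `L`.
* Reading (THEORY-1 §31.3; the zero locations are PRINTED MCMC ESTIMATES = NON-RIGOROUS INPUT,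
  exactly as in §24.2): `SU(3)`, `4⁴`, `β₀ = 5.550(3) ± 0.098(4)i` (Alves–Berg–Sanielevici 1992,
  arXiv:hep-lat/9107002, Table 8) ⇒ `s₀ = β₀/3 ≈ 1.850 + 0.033i`; from `β = 0` to `β = 6`
  (`s = 2`) with `η = ½` EVERY such staircase has `K ≥ (arsinh 56.6 + arsinh 4.59)/log 2 = 10.04`,
  i.e. at least `11` stages (log form: `10`; the optimal chain w.r.t. this single zero has `13`);
  `SU(2)`, `4⁴`, `β₀ = 2.18 ± 0.18i` (arXiv:0710.5771), `β = 2.4` ⇒ `K ≥ 6.09`, i.e. `7` stages.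
  If zeros pinch the real axis (`|Im s₀(L)| ≤ C L^{-κ}`, first-order / deconfining geometry) the
  count grows like `κ log L / log(1/η)`. NO physics claim; nothing is claimed about
  non-perturbative (trained) flows, complex coupling paths, or the map's gradient series.

References: M. Lüscher, Commun. Math. Phys. 293 (2010) 899–919, §4 [bib `Luscher2010Trivializing`];
M. E. Fisher, Lectures in Theoretical Physics VII C (1965) 1; F. W. Gehring, B. P. Palka, J. Anal.
Math. 30 (1976) 172–199 (quasihyperbolic length; cf. arXiv:1104.3745, Def. 5); THEORY-1.md §24,
§31.
-/

open MeasureTheory ProbabilityTheory Filter Topology Complex Set Metric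
open Literature.MathematicalPhysics.QuantumFieldTheory
open Literature.MathematicalPhysics.QuantumFieldTheory.Luscher2010
open Literature.MathematicalPhysics.QuantumFieldTheory.WilsonFlow (coeConfig continuous_coeConfig)
open scoped Matrix Matrix.Norms.Frobenius ContDiff

namespace Summit.Ventures.LatticeQCDFlow.TrivializingMaps

/-! ## §1 The quasihyperbolic length of an admissible real chain, in closed form (pure) -/

namespace Staircase

/-- **One admissible step has quasihyperbolic length at most `log(1/η)`** (closed form): if
`V ≤ u + (1-η)√(1+u²)` with `0 < η` then `arsinh V ≤ arsinh u + log(1/η)`; the increments agree in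
the limit `u → -∞`. Proof: with `t = arsinh u`,
`sinh(t + log(1/η)) - (sinh t + (1-η) cosh t) = (1-η)² e^t/(2η) ≥ 0`. [ours] -/
theorem arsinh_le_arsinh_add_log {η u V : ℝ} (hη0 : 0 < η)
    (hV : V ≤ u + (1 - η) * Real.sqrt (1 + u ^ 2)) :
    Real.arsinh V ≤ Real.arsinh u + Real.log (1 / η) := by
  have hη : η ≠ 0 := hη0.ne'
  set w := Real.sqrt (1 + u ^ 2) with hw
  have huw : 0 ≤ u + w := by
    have : |u| ≤ w := by
      rw [hw, ← Real.sqrt_sq_eq_abs]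
      exact Real.sqrt_le_sqrt (by nlinarith)
    linarith [neg_abs_le u]
  have key : u + (1 - η) * w ≤ Real.sinh (Real.arsinh u + Real.log (1 / η)) := by
    rw [Real.sinh_add, Real.sinh_arsinh, Real.cosh_arsinh, ← hw,
      Real.cosh_log (by positivity : (0:ℝ) < 1 / η), Real.sinh_log (by positivity : (0:ℝ) < 1 / η),
      one_div, inv_inv]
    have h2 : u + (1 - η) * w
        = u * ((η⁻¹ + η) / 2) + w * ((η⁻¹ - η) / 2) - (1 - η) ^ 2 / (2 * η) * (u + w) := by
      field_simp
      ring
    rw [h2]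
    have h3 : 0 ≤ (1 - η) ^ 2 / (2 * η) * (u + w) :=
      mul_nonneg (div_nonneg (sq_nonneg _) (by positivity)) huw
    linarith
  calc Real.arsinh V ≤ Real.arsinh (u + (1 - η) * w) := Real.arsinh_le_arsinh.mpr hV
    _ ≤ Real.arsinh u + Real.log (1 / η) := by
        rw [← Real.sinh_le_sinh, Real.sinh_arsinh]; exact key

/-- `|x - z| = |Im z| √(1 + ((x - Re z)/|Im z|)²)` for real `x` and non-real `z`. [folklore] -/
theorem norm_ofReal_sub_eq {z : ℂ} (hz : z.im ≠ 0) (x : ℝ) :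
    ‖(x : ℂ) - z‖ = |z.im| * Real.sqrt (1 + ((x - z.re) / |z.im|) ^ 2) := by
  have hb : 0 < |z.im| := abs_pos.mpr hz
  rw [← Real.sqrt_sq hb.le, ← Real.sqrt_mul (sq_nonneg _), Real.sqrt_sq hb.le,
    ← Real.sqrt_sq (norm_nonneg _), Literature.Analysis.DeBrangesSpaces.norm_ofReal_sub_sq]
  congr 1
  have : z.im ^ 2 = |z.im| ^ 2 := (sq_abs _).symm
  rw [this]
  field_simp
  ring

/-- **THEOREM S (geometric core, quasihyperbolic form) —
`K · log(1/η) ≥ arsinh((x_K - Re z)/|Im z|) - arsinh((x₀ - Re z)/|Im z|)`.** For a real chain with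
`x_{k+1} - x_k ≤ (1-η)|x_k - z|` (`k < K`, `0 < η`, `z ∉ ℝ`) the right-hand side is the
quasihyperbolic length `∫_{x₀}^{x_K} dx/|x - z|` of the segment in `ℂ ∖ {z}` (Gehring–Palka), and
each step has length `≤ log(1/η)` (`arsinh_le_arsinh_add_log`). No monotonicity of the chain is
needed. With `x₀ < Re z ≤ x_K` the bound reads
`K ≥ (arsinh((Re z - x₀)/|Im z|) + arsinh((x_K - Re z)/|Im z|))/log(1/η)`; it complements the
`log` form `Staircase.count_ge` of `FisherStaircaseChain` (sharper before the crossing, where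
`arsinh y ≥ log(2y)`; `count_ge` is sharper in the receding factor `2-η` after it). [ours] -/
theorem arsinh_sub_arsinh_le {z : ℂ} (hz : z.im ≠ 0) {x : ℕ → ℝ} {η : ℝ} (hη0 : 0 < η) {K : ℕ}
    (h : ∀ k < K, x (k + 1) - x k ≤ (1 - η) * ‖(x k : ℂ) - z‖) :
    Real.arsinh ((x K - z.re) / |z.im|) - Real.arsinh ((x 0 - z.re) / |z.im|)
      ≤ K * Real.log (1 / η) := by
  induction K with
  | zero => simp
  | succ K ih =>
    have hb : 0 < |z.im| := abs_pos.mpr hz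
    have ih' := ih fun k hk => h k (Nat.lt_succ_of_lt hk)
    have hK := h K (Nat.lt_succ_self K)
    rw [norm_ofReal_sub_eq hz] at hK
    have hstep : Real.arsinh ((x (K + 1) - z.re) / |z.im|)
        ≤ Real.arsinh ((x K - z.re) / |z.im|) + Real.log (1 / η) := by
      refine arsinh_le_arsinh_add_log hη0 ?_
      have e1 : (x (K + 1) - z.re) / |z.im|
          = (x K - z.re) / |z.im| + (x (K + 1) - x K) / |z.im| := by
        rw [← add_div]; congr 1; ring
      rw [e1, add_le_add_iff_left, div_le_iff₀ hb]
      calc x (K + 1) - x K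
          ≤ (1 - η) * (|z.im| * Real.sqrt (1 + ((x K - z.re) / |z.im|) ^ 2)) := hK
        _ = (1 - η) * Real.sqrt (1 + ((x K - z.re) / |z.im|) ^ 2) * |z.im| := by ring
    push_cast
    linarith

end Staircase

/-! ## §2 The partition function `Z(s) = ∫ D[U] e^{-sS}`: real centres, stages, THEOREM S -/

section ActionZ

variable {d L n : ℕ} [NeZero L] {B : SuBasis n} {S : AmbConfig d L n → ℝ}
  {Sk : ℕ → AmbConfig d L n → ℝ} {c : ℕ → ℝ}

/-- **`Z` is positive on the real axis** (`Z(x) = ∫ D[U] e^{-xS} > 0`): every real coupling is an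
admissible centre, and every Fisher zero is off the real axis. [folklore] -/
theorem actionZ_ofReal_pos (hS : ContDiff ℝ ∞ S) (x : ℝ) :
    ∃ y : ℝ, 0 < y ∧ complexMGF (fun U => -S (coeConfig U))
      (trivialMeasure (Matrix.specialUnitaryGroup (Fin n) ℂ) d L) x = y :=
  ⟨mgf (fun U => -S (coeConfig U)) (trivialMeasure (Matrix.specialUnitaryGroup (Fin n) ℂ) d L) x,
    mgf_pos (integrable_trivialMeasure_of_continuous (Real.continuous_exp.comp
      (continuous_const.mul (continuous_comp_coeConfig hS).neg))), complexMGF_ofReal x⟩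

/-- `Z(x) ≠ 0` for real `x`. [folklore] -/
theorem actionZ_ofReal_ne_zero (hS : ContDiff ℝ ∞ S) (x : ℝ) :
    complexMGF (fun U => -S (coeConfig U))
      (trivialMeasure (Matrix.specialUnitaryGroup (Fin n) ℂ) d L) x ≠ 0 := by
  obtain ⟨y, hy, h⟩ := actionZ_ofReal_pos (d := d) (L := L) (n := n) hS x
  rw [h]
  exact_mod_cast hy.ne'

/-- A Fisher zero of `Z` has non-zero imaginary part. [folklore] -/
theorem im_ne_zero_of_actionZ_eq_zero (hS : ContDiff ℝ ∞ S) {s₀ : ℂ}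
    (hz : complexMGF (fun U => -S (coeConfig U))
      (trivialMeasure (Matrix.specialUnitaryGroup (Fin n) ℂ) d L) s₀ = 0) : s₀.im ≠ 0 := by
  intro him
  have hre : ((s₀.re : ℝ) : ℂ) = s₀ := Complex.ext (by simp) (by simp [him])
  exact actionZ_ofReal_ne_zero (d := d) (L := L) (n := n) hS s₀.re (by rw [hre]; exact hz)

namespace Staircase

/-- **Stage `0` of the staircase IS Lüscher's series**: for every smooth Lüscher series of `S`,
`(k!)⁻¹ (Z′/Z)^{(k)}(0) = Ċ^{(k)}` (THEOREM F″(i) on a zero-free disc about `0`, which exists as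
`Z(0) = 1`). [cite: Luscher2010Trivializing, §4.2–§4.3] -/
theorem luscher_stage_zero (h : IsLuscherSeries B S Sk c) (hS : ContDiff ℝ ∞ S)
    (hSk : ∀ k, ContDiff ℝ ∞ (Sk k)) (k : ℕ) :
    (k.factorial : ℂ)⁻¹ * iteratedDeriv k (fun w => deriv (complexMGF (fun U => -S (coeConfig U))
        (trivialMeasure (Matrix.specialUnitaryGroup (Fin n) ℂ) d L)) w /
      complexMGF (fun U => -S (coeConfig U))
        (trivialMeasure (Matrix.specialUnitaryGroup (Fin n) ℂ) d L) w) 0 = c k := by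
  set Z := complexMGF (fun U => -S (coeConfig U))
    (trivialMeasure (Matrix.specialUnitaryGroup (Fin n) ℂ) d L) with hZdef
  have hZd : Differentiable ℂ Z := differentiable_actionZ hS
  have hZ0 : Z 0 ≠ 0 := by rw [hZdef, actionZ_zero S]; exact one_ne_zero
  obtain ⟨ρ₀, hρ₀, hZρ⟩ : ∃ ρ₀ > 0, ∀ w ∈ ball (0 : ℂ) ρ₀, Z w ≠ 0 := by
    have hev : ∀ᶠ w in 𝓝 (0 : ℂ), Z w ≠ 0 := hZd.continuous.continuousAt.eventually_ne hZ0
    obtain ⟨ρ₀, hρ₀, hball⟩ := Metric.eventually_nhds_iff.mp hev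
    exact ⟨ρ₀, hρ₀, fun w hw => hball (mem_ball.mp hw)⟩
  have hr : (0 : ℝ) < ρ₀ / 2 := by positivity
  have hZr : ∀ w ∈ closedBall (0 : ℂ) (ρ₀ / 2), Z w ≠ 0 := fun w hw =>
    hZρ w (closedBall_subset_ball (by linarith) hw)
  rw [IsLuscherSeries.iteratedDeriv_logDeriv_actionZ_eq h hS hSk hr hZr k]
  have hk : (k.factorial : ℂ) ≠ 0 := by exact_mod_cast k.factorial_ne_zero
  field_simp

/-- **One stage, exact reach.** A stage centred at the real coupling `x` whose series is summable
at the real point `x + Δ/(1-η)` (`Δ ≥ 0`, `η < 1`: the step `Δ` uses at most the fraction `1-η`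
of the stage's radius) satisfies `Δ ≤ (1-η)|x - s₀|` for EVERY zero `s₀` of `Z`. [ours] -/
theorem step_le_of_stage_summable (hS : ContDiff ℝ ∞ S) {x Δ η : ℝ} (hΔ : 0 ≤ Δ) (hη : η < 1)
    (hsum : Summable fun k : ℕ => (k.factorial : ℂ)⁻¹ *
      iteratedDeriv k (fun w => deriv (complexMGF (fun U => -S (coeConfig U))
          (trivialMeasure (Matrix.specialUnitaryGroup (Fin n) ℂ) d L)) w /
        complexMGF (fun U => -S (coeConfig U))
          (trivialMeasure (Matrix.specialUnitaryGroup (Fin n) ℂ) d L) w) x *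
      (((x + Δ / (1 - η) : ℝ) : ℂ) - x) ^ k)
    {s₀ : ℂ} (hz : complexMGF (fun U => -S (coeConfig U))
      (trivialMeasure (Matrix.specialUnitaryGroup (Fin n) ℂ) d L) s₀ = 0) :
    Δ ≤ (1 - η) * ‖(x : ℂ) - s₀‖ := by
  have h1 := norm_sub_le_of_logDeriv_taylor_summable (differentiable_actionZ hS)
    (actionZ_ofReal_ne_zero (d := d) (L := L) (n := n) hS x) hsum hz
  have h1η : 0 < 1 - η := sub_pos.mpr hη
  have h2 : ‖(((x + Δ / (1 - η) : ℝ) : ℂ)) - (x : ℂ)‖ = Δ / (1 - η) := by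
    rw [← ofReal_sub, norm_real, Real.norm_eq_abs, add_sub_cancel_left,
      abs_of_nonneg (div_nonneg hΔ h1η.le)]
  rw [h2, norm_sub_rev] at h1
  rwa [div_le_iff₀ h1η, mul_comm] at h1

/-- **THEOREM S — the Fisher staircase (geometric form).** For a smooth action `S`, a zero `s₀` of
`Z(s) = ∫ D[U] e^{-sS}`, and a staircase `x₀ ≤ x₁ ≤ … ≤ x_K` of real couplings each of whose
stages `k < K` (the Taylor series of `Z′/Z = -⟨S⟩` at `x_k`) is summable at `x_k + Δ_k/(1-η)`
(`Δ_k = x_{k+1} - x_k`, margin `0 ≤ η < 1`): `η^K |x₀ - s₀| ≤ |x_K - s₀|`. [ours] -/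
theorem actionZ_pow_mul_dist_le (hS : ContDiff ℝ ∞ S) {s₀ : ℂ}
    (hz : complexMGF (fun U => -S (coeConfig U))
      (trivialMeasure (Matrix.specialUnitaryGroup (Fin n) ℂ) d L) s₀ = 0)
    {η : ℝ} (hη0 : 0 ≤ η) (hη1 : η < 1) {K : ℕ} {x : ℕ → ℝ} (hmono : ∀ k < K, x k ≤ x (k + 1))
    (hadm : ∀ k < K, Summable fun j : ℕ => (j.factorial : ℂ)⁻¹ *
      iteratedDeriv j (fun w => deriv (complexMGF (fun U => -S (coeConfig U))
          (trivialMeasure (Matrix.specialUnitaryGroup (Fin n) ℂ) d L)) w /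
        complexMGF (fun U => -S (coeConfig U))
          (trivialMeasure (Matrix.specialUnitaryGroup (Fin n) ℂ) d L) w) (x k) *
      (((x k + (x (k + 1) - x k) / (1 - η) : ℝ) : ℂ) - x k) ^ j) :
    η ^ K * ‖(x 0 : ℂ) - s₀‖ ≤ ‖(x K : ℂ) - s₀‖ :=
  pow_mul_dist_le (x := fun k => (x k : ℂ)) hη0 fun k hk => by
    rw [← ofReal_sub, norm_real, Real.norm_eq_abs, abs_of_nonneg (sub_nonneg.mpr (hmono k hk))]
    exact step_le_of_stage_summable hS (sub_nonneg.mpr (hmono k hk)) hη1 (hadm k hk) hz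

/-- **THEOREM S — the Fisher staircase (stage count).** Same setting, `0 < η < 1`, and the
staircase passes the abscissa of the zero (`x₀ < Re s₀ ≤ x_K`; e.g. `x₀ = 0`, `x_K = β/N` beyond a
zero of the volume-`L` Wilson partition function). Then the number of stages obeys
`K ≥ log(|x₀ - s₀|√(η(2-η))/|Im s₀|)/log(1/η) + log(|x_K - s₀|√(η(2-η))/|Im s₀|)/log(2-η)`.
[ours] -/
theorem actionZ_count_ge (hS : ContDiff ℝ ∞ S) {s₀ : ℂ}
    (hz : complexMGF (fun U => -S (coeConfig U))
      (trivialMeasure (Matrix.specialUnitaryGroup (Fin n) ℂ) d L) s₀ = 0)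
    {η : ℝ} (hη0 : 0 < η) (hη1 : η < 1) {K : ℕ} {x : ℕ → ℝ} (hmono : ∀ k < K, x k ≤ x (k + 1))
    (hadm : ∀ k < K, Summable fun j : ℕ => (j.factorial : ℂ)⁻¹ *
      iteratedDeriv j (fun w => deriv (complexMGF (fun U => -S (coeConfig U))
          (trivialMeasure (Matrix.specialUnitaryGroup (Fin n) ℂ) d L)) w /
        complexMGF (fun U => -S (coeConfig U))
          (trivialMeasure (Matrix.specialUnitaryGroup (Fin n) ℂ) d L) w) (x k) *
      (((x k + (x (k + 1) - x k) / (1 - η) : ℝ) : ℂ) - x k) ^ j)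
    (h0 : x 0 < s₀.re) (hK : s₀.re ≤ x K) :
    Real.log (‖(x 0 : ℂ) - s₀‖ * Real.sqrt (η * (2 - η)) / |s₀.im|) / Real.log (1 / η) +
      Real.log (‖(x K : ℂ) - s₀‖ * Real.sqrt (η * (2 - η)) / |s₀.im|) / Real.log (2 - η) ≤ K :=
  count_ge hη0 hη1 hmono (fun k hk =>
    step_le_of_stage_summable hS (sub_nonneg.mpr (hmono k hk)) hη1 (hadm k hk) hz) h0 hK

/-- **THEOREM S — the Fisher staircase (quasihyperbolic form).** Same setting (`0 < η < 1`, no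
crossing hypothesis): `K log(1/η) ≥ arsinh((x_K - Re s₀)/|Im s₀|) - arsinh((x₀ - Re s₀)/|Im s₀|)`,
the quasihyperbolic length of `[x₀, x_K]` in `ℂ ∖ {s₀}`. [ours] -/
theorem actionZ_arsinh_sub_le (hS : ContDiff ℝ ∞ S) {s₀ : ℂ}
    (hz : complexMGF (fun U => -S (coeConfig U))
      (trivialMeasure (Matrix.specialUnitaryGroup (Fin n) ℂ) d L) s₀ = 0)
    {η : ℝ} (hη0 : 0 < η) (hη1 : η < 1) {K : ℕ} {x : ℕ → ℝ} (hmono : ∀ k < K, x k ≤ x (k + 1))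
    (hadm : ∀ k < K, Summable fun j : ℕ => (j.factorial : ℂ)⁻¹ *
      iteratedDeriv j (fun w => deriv (complexMGF (fun U => -S (coeConfig U))
          (trivialMeasure (Matrix.specialUnitaryGroup (Fin n) ℂ) d L)) w /
        complexMGF (fun U => -S (coeConfig U))
          (trivialMeasure (Matrix.specialUnitaryGroup (Fin n) ℂ) d L) w) (x k) *
      (((x k + (x (k + 1) - x k) / (1 - η) : ℝ) : ℂ) - x k) ^ j) :
    Real.arsinh ((x K - s₀.re) / |s₀.im|) - Real.arsinh ((x 0 - s₀.re) / |s₀.im|)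
      ≤ K * Real.log (1 / η) :=
  arsinh_sub_arsinh_le (im_ne_zero_of_actionZ_eq_zero (d := d) (L := L) (n := n) hS hz) hη0
    fun k hk => step_le_of_stage_summable hS (sub_nonneg.mpr (hmono k hk)) hη1 (hadm k hk) hz

end Staircase

end ActionZ

/-! ## §3 Wilson action (`S_W = ∑_p Re tr(1 - U_p)`, `s = β/N`) -/

section Wilson

variable {d L n : ℕ} [NeZero L]

/-- **COROLLARY S (Wilson action).** A zero `s₀` of the volume-`L` Wilson partition function
`Z_L(s) = ∫ D[U] e^{-s S_W}` forces every `η`-margined perturbative staircase of re-expanded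
flow-constant series from `x₀ < Re s₀` to `x_K ≥ Re s₀` to have at least
`log(|x₀ - s₀|√(η(2-η))/|Im s₀|)/log(1/η) + log(|x_K - s₀|√(η(2-η))/|Im s₀|)/log(2-η)` stages.
[ours; cf. Luscher2010Trivializing §4.5(b)] -/
theorem wilson_staircase_count_ge {s₀ : ℂ}
    (hz : complexMGF (fun U => -ambWilsonAction (coeConfig U))
      (trivialMeasure (Matrix.specialUnitaryGroup (Fin n) ℂ) d L) s₀ = 0)
    {η : ℝ} (hη0 : 0 < η) (hη1 : η < 1) {K : ℕ} {x : ℕ → ℝ} (hmono : ∀ k < K, x k ≤ x (k + 1))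
    (hadm : ∀ k < K, Summable fun j : ℕ => (j.factorial : ℂ)⁻¹ *
      iteratedDeriv j (fun w => deriv (complexMGF (fun U => -ambWilsonAction (coeConfig U))
          (trivialMeasure (Matrix.specialUnitaryGroup (Fin n) ℂ) d L)) w /
        complexMGF (fun U => -ambWilsonAction (coeConfig U))
          (trivialMeasure (Matrix.specialUnitaryGroup (Fin n) ℂ) d L) w) (x k) *
      (((x k + (x (k + 1) - x k) / (1 - η) : ℝ) : ℂ) - x k) ^ j)
    (h0 : x 0 < s₀.re) (hK : s₀.re ≤ x K) :
    Real.log (‖(x 0 : ℂ) - s₀‖ * Real.sqrt (η * (2 - η)) / |s₀.im|) / Real.log (1 / η) +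
      Real.log (‖(x K : ℂ) - s₀‖ * Real.sqrt (η * (2 - η)) / |s₀.im|) / Real.log (2 - η) ≤ K :=
  Staircase.actionZ_count_ge (d := d) (L := L) (n := n) contDiff_ambWilsonAction hz hη0 hη1 hmono
    hadm h0 hK

/-- **COROLLARY S (Wilson action, quasihyperbolic form):** `K log(1/η) ≥
arsinh((x_K - Re s₀)/|Im s₀|) - arsinh((x₀ - Re s₀)/|Im s₀|)` for every zero `s₀` of `Z_L`.
[ours] -/
theorem wilson_staircase_arsinh_le {s₀ : ℂ}
    (hz : complexMGF (fun U => -ambWilsonAction (coeConfig U))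
      (trivialMeasure (Matrix.specialUnitaryGroup (Fin n) ℂ) d L) s₀ = 0)
    {η : ℝ} (hη0 : 0 < η) (hη1 : η < 1) {K : ℕ} {x : ℕ → ℝ} (hmono : ∀ k < K, x k ≤ x (k + 1))
    (hadm : ∀ k < K, Summable fun j : ℕ => (j.factorial : ℂ)⁻¹ *
      iteratedDeriv j (fun w => deriv (complexMGF (fun U => -ambWilsonAction (coeConfig U))
          (trivialMeasure (Matrix.specialUnitaryGroup (Fin n) ℂ) d L)) w /
        complexMGF (fun U => -ambWilsonAction (coeConfig U))
          (trivialMeasure (Matrix.specialUnitaryGroup (Fin n) ℂ) d L) w) (x k) *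
      (((x k + (x (k + 1) - x k) / (1 - η) : ℝ) : ℂ) - x k) ^ j) :
    Real.arsinh ((x K - s₀.re) / |s₀.im|) - Real.arsinh ((x 0 - s₀.re) / |s₀.im|)
      ≤ K * Real.log (1 / η) :=
  Staircase.actionZ_arsinh_sub_le (d := d) (L := L) (n := n) contDiff_ambWilsonAction hz hη0 hη1
    hmono hadm

/-- **The converse side: below the volume-uniform zero-free radius ONE stage serves every volume.**
There is `ρ > 0` (THEOREM A + F′, `wilson_actionZ_zeroFree_uniform`) such that for EVERY periodic
volume `L` the stage-`0` series (Lüscher's flow-constant series, `Staircase.luscher_stage_zero`)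
sums to `Z_L′/Z_L` at every complex `|s| < ρ`. [ours; cf. Luscher2010Trivializing §4.5(b)] -/
theorem wilson_one_stage_of_uniform_radius (d n : ℕ) (B : SuBasis n) :
    ∃ ρ : ℝ, 0 < ρ ∧ ∀ (L : ℕ) [NeZero L] (s : ℂ), ‖s‖ < ρ →
      HasSum (fun k : ℕ => (k.factorial : ℂ)⁻¹ *
        iteratedDeriv k (fun w => deriv (complexMGF (fun U => -ambWilsonAction (coeConfig U))
            (trivialMeasure (Matrix.specialUnitaryGroup (Fin n) ℂ) d L)) w /
          complexMGF (fun U => -ambWilsonAction (coeConfig U))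
            (trivialMeasure (Matrix.specialUnitaryGroup (Fin n) ℂ) d L) w) 0 * (s - 0) ^ k)
        (deriv (complexMGF (fun U => -ambWilsonAction (coeConfig U))
            (trivialMeasure (Matrix.specialUnitaryGroup (Fin n) ℂ) d L)) s /
          complexMGF (fun U => -ambWilsonAction (coeConfig U))
            (trivialMeasure (Matrix.specialUnitaryGroup (Fin n) ℂ) d L) s) := by
  obtain ⟨ρ, hρ, hZ⟩ := wilson_actionZ_zeroFree_uniform d n B
  refine ⟨ρ, hρ, ?_⟩
  intro L hL s hs
  have hd : Differentiable ℂ (complexMGF (fun U => -ambWilsonAction (coeConfig U))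
      (trivialMeasure (Matrix.specialUnitaryGroup (Fin n) ℂ) d L)) :=
    differentiable_actionZ (d := d) (L := L) (n := n) contDiff_ambWilsonAction
  exact logDeriv_taylor_hasSum_of_zeroFree hd.differentiableOn
    (fun w hw => hZ L w (mem_ball_zero_iff.mp hw)) (mem_ball_zero_iff.mpr hs)

end Wilson

end Summit.Ventures.LatticeQCDFlow.TrivializingMaps
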